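import Summits.HodgeConjecture.HodgeConjecture.Theorems.F0P2oPrincipalSeriesUniqueIrrSub           -- ★ p831178: `areIsomorphicRep_of_intertwiningMap_normalizedInd_ne_zero`
import HarnessLib

/-!
# Crux `H413`, programme P2 — road (T) step (4), GENERIC PART (pointer-friendly restatement): sub-uniqueness for a representation `I` GIVEN
# `I = i_P^G(χ)`, with the Jacquet-module data FIRST in the binder list

Cell hodgecm-mathlib (D-0151), FLOOR 0, crux H413 = stmt-HodgeConjecture-24833; companion of ★ `F0P2oPrincipalSeriesUniqueIrrSub` (F0P2-p02 (g6) p831178).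
THEOREMS ONLY (generic); Lines-free; no named fact.

WHY THIS RESTATEMENT EXISTS (an elaboration-engineering fact, recorded for the cell).  The CM consumer `principalSeries_uniqueSub (hN1) : ‹h4›` must feed the six
conjuncts of the N1 letter ★ `UnitaryGroup.U3PrincipalSeriesJacquetFiltration` (a `def … : Prop`, whose elaborated body carries its own auxiliary proof constants
`…._proof_1 … _proof_8` inside the instance towers of `LocalRing L v`) into a generic theorem.  Measured (F0P2-p02 (g6) probes D3–D11, 2026-08-31): the definitional
comparison of an N1 conjunct with ANY re-elaboration of the same text costs > 4·10⁵ heartbeats per conjunct (the `FiniteDimensional` ∕ `finrank` ∕ `Submodule` conjuncts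
each exceed the 400 000 cap; the whole statement exceeds 3·10⁶), although the two terms are structurally identical modulo the NAMES of the auxiliary proof constants —
the mismatch defeats the syntactic-equality shortcut and the unifier then unfolds the `adicCompletion` field structure (`Semifield.toDivisionSemiring …`) by brute force.
The cure is to let unification INSTANTIATE a generic statement from N1's own subterms (pointer-equal, hence free): so here the representation `I` is ABSTRACT (a variable
of the carrier type of `i_P^G(χ)`), the Jacquet data `ℓ, hfd, h2, hℓ1, hℓ, hq` come FIRST (they fix `G`, the instances, `t`, `χ`, `χ′`, `I` by unification), and the
identification `I = normalizedInd t (𝟙 ⊗ χ)` is a HYPOTHESIS `hI` (discharged by `rfl` at the CM instance: `cmPrincipalSeries L 3 v χ` unfolds to it), used by `subst`.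
[cite: Casselman1995, Lemma 7.1.1 (a) p. 67; §6.3 Thm. 6.3.5 p. 59] [cite: BernsteinZelevinsky1977, Prop. 1.9 (a)–(c); Thm. 2.4 (b)]

## References
* [Casselman1995] W. Casselman, *Introduction to the theory of admissible representations of p-adic reductive groups* (1995): Thm. 3.2.4, §6.3 Thm. 6.3.5 p. 59,
  Lemma 7.1.1 (a) p. 67.
* [BernsteinZelevinsky1977] I. N. Bernstein, A. V. Zelevinsky, Ann. Sci. ÉNS 10 (1977): Prop. 1.9 (a)–(c), §2.3, Thm. 2.4 (b).
-/

set_option autoImplicit false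
-- the mandated namespace has the single-problem summit's repeated segment (`HodgeConjecture.HodgeConjecture`)
set_option linter.dupNamespace false

noncomputable section

open Literature.NumberTheory Literature.NumberTheory.Automorphic Literature.NumberTheory.Automorphic.Liu2021

namespace Summit.HodgeConjecture.HodgeConjecture.Cruxes.H413.F0P2oPrincipalSeriesUniqueIrrSub

universe u

/-- **SUB-UNIQUENESS FOR `I = i_P^G(χ)`, `χ ≠ χ′`, Jacquet data first (generic; the pointer-friendly form of ★
`areIsomorphicRep_of_intertwiningMap_normalizedInd_ne_zero`).**  For a parabolic triple `t = (P, M, N)` (`N` a union of compact open subgroups, `δ_P|_N = 1`), characters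
`χ ≠ χ′` of `M`, and a representation `I` of `G` on the carrier of `i_P^G(χ)` WITH `I = i_P^G(χ)` (hypothesis `hI`): if `r_P I` is 2-dimensional with an `M`-line `ℓ` of
character `χ′` and quotient character `χ`, then two irreducible `π₁, π₂` with non-zero `Φᵢ : πᵢ → I` are isomorphic (★ `AreIsomorphicRep`).  Proof: `subst hI` and ★
`areIsomorphicRep_of_intertwiningMap_normalizedInd_ne_zero`.  Binder order is load-bearing for the CM consumer (see the module docstring).
[cite: Casselman1995, Lemma 7.1.1 (a) p. 67; §6.3 Thm. 6.3.5 p. 59; Thm. 3.2.4] [cite: BernsteinZelevinsky1977, Prop. 1.9 (a)–(c); Thm. 2.4 (b)] -/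
theorem areIsomorphicRep_of_eq_normalizedInd
    {G : Type u} [Group G] [TopologicalSpace G] [IsTopologicalGroup G] {t : ParabolicTriple G} [LocallyCompactSpace t.P]
    {χ χ' : ↥t.M →* ℂˣ}
    {I : Representation ℂ G (Representation.SmoothInd t.P
      (Representation.twist (((Representation.trivial ℂ ↥t.M ℂ).twist χ).comp t.proj) (rootDeltaChar t.P)))}
    (ℓ : Submodule ℂ (t.restrict I).Coinvariants)
    (hfd : FiniteDimensional ℂ (t.restrict I).Coinvariants) (h2 : Module.finrank ℂ (t.restrict I).Coinvariants = 2)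
    (hℓ1 : Module.finrank ℂ ↥ℓ = 1)
    (hℓ : ∀ (m : ↥t.M), ∀ x ∈ ℓ, I.normalizedJacquet t m x = ((χ' m : ℂˣ) : ℂ) • x)
    (hq : ∀ (m : ↥t.M) (x : (t.restrict I).Coinvariants), I.normalizedJacquet t m x - ((χ m : ℂˣ) : ℂ) • x ∈ ℓ)
    (hne : χ ≠ χ')
    (hI : I = Representation.normalizedInd t ((Representation.trivial ℂ ↥t.M ℂ).twist χ))
    (hN : IsLimitOfCompactOpen t.N)
    (hδ : ∀ (n : G) (hn : n ∈ t.N), deltaChar t.P ⟨n, t.N_le hn⟩ = 1)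
    {V₁ V₂ : Type*} [AddCommGroup V₁] [Module ℂ V₁] [AddCommGroup V₂] [Module ℂ V₂]
    {π₁ : Representation ℂ G V₁} {π₂ : Representation ℂ G V₂} (hπ₁ : π₁.IsIrreducible) (hπ₂ : π₂.IsIrreducible)
    (Φ₁ : π₁.IntertwiningMap I) (Φ₂ : π₂.IntertwiningMap I) (hΦ₁ : Φ₁ ≠ 0) (hΦ₂ : Φ₂ ≠ 0) :
    AreIsomorphicRep π₁ π₂ := by
  subst hI
  exact areIsomorphicRep_of_intertwiningMap_normalizedInd_ne_zero t hN χ χ' hne hδ hfd h2 ℓ hℓ1 hℓ hq hπ₁ hπ₂ Φ₁ Φ₂ hΦ₁ hΦ₂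

end Summit.HodgeConjecture.HodgeConjecture.Cruxes.H413.F0P2oPrincipalSeriesUniqueIrrSub

end
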